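import Mathlib
import HarnessLib
import Summits.NavierStokesRegularity.NavierStokesRegularity.Theorems.LocalVelCompTubeDoorAxisymOffAxis

/-!
# The door family in the HELICAL regime (helical swirl allowed): every locally Type-I point is backward bounded

Cell ns-regularity-ideate, seat p6 (route-directed support for the door family of LADDER-NS N0; sibling of
`…LocalVelCompTubeDoorAxisymOffAxis`).  A flow equivariant under the screw motions `x ↦ R_θ x + (h θ) e₂` of pitch
`h ≠ 0` about the vertical axis (helical symmetry, helical swirl allowed) has NO fixed points of the symmetry: the helical
Killing field `ξ(x) = J x + h e₂` vanishes nowhere.  Hence at EVERY point `x₀` the screw motions act on the zoom chart as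
translations in the limit, `S_{λⱼ l}(x₀ + λⱼ y) = x₀ + λⱼ yⱼ` with `yⱼ → y + l • ξ(x₀)`, and the DIAGONAL velocity zoom
(`localPointZoomVelSlicesDiag`) + equivariance + joint continuity of the rotations give a blow-up profile that is
translation-invariant along `ξ(x₀) ≠ 0` on every slice — a settled stratum (`nonflatLiouville_of_translate_eq_slice`):

* `isBackwardBoundedAt_of_localTypeI_helical` — **classical Leray–Hopf solution from a rapidly decaying datum,
  helically symmetric with pitch `h ≠ 0` at every time, locally Type I at `(x₀, T)` ⇒ backward bounded at `(x₀, T)`,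
  for EVERY `x₀`.**

Honest placement: helically symmetric Navier–Stokes flows are globally regular in print (Mahalov–Titi–Leibovich 1990);
new here only as a kernel statement by the doors' zoom/strata mechanism, and only the local-Type-I form.

WHAT THIS IS NOT: not a claim about Navier–Stokes regularity (Clay A) — the helical S-restricted case of the door family
(bears_on LADDER-NS N0).
-/

noncomputable section

-- the summit and its single sub-problem share the name (CONVENTIONS §1), as in every Theorems file
set_option linter.dupNamespace false

namespace Summit.NavierStokesRegularity.NavierStokesRegularity.Theorems.LocalVelCompTubeDoorHelical

open MeasureTheory Set Function Filter Topology TopologicalSpace Metric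
open scoped RealInnerProductSpace InnerProductSpace
open Literature.Analysis Literature.Analysis.FluidPDE
open Summit.NavierStokesRegularity.NavierStokesRegularity.Theorems.LocalVelCompTubeDoorLocalPointZoomVelSlicesDiag
open Summit.NavierStokesRegularity.NavierStokesRegularity.Theorems.PoloidalWindowDoorPoloidalWindowRigidityFlat
open Summit.NavierStokesRegularity.NavierStokesRegularity.Theorems.PoloidalWindowDoorPoloidalWindowRigidityOneSlice
open Summit.NavierStokesRegularity.NavierStokesRegularity.Theorems.LocalVelCompTubeDoorAxisymOffAxis

/-- The helical Killing field `ξ(x) = J x + h e₂` vanishes nowhere when the pitch `h ≠ 0`. -/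
theorem rotGen_add_pitch_ne_zero (x : EuclideanSpace ℝ (Fin 3)) {h : ℝ} (hh : h ≠ 0) :
    rotGen x + h • eZ ≠ 0 := by
  intro h0
  have := congrArg (fun w : EuclideanSpace ℝ (Fin 3) => w 2) h0
  simp [eZ, hh] at this

/-- **Helically symmetric (pitch `h ≠ 0`, helical swirl allowed) + local Type I at `(x₀,T)` ⇒ backward bounded**, at
EVERY point `x₀`. -/
theorem isBackwardBoundedAt_of_localTypeI_helical
    (ν T : ℝ) (hν : 0 < ν) (hT : 0 < T) (u : ℝ → EuclideanSpace ℝ (Fin 3) → EuclideanSpace ℝ (Fin 3))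
    (p : ℝ → EuclideanSpace ℝ (Fin 3) → ℝ)
    (hcl : IsClassicalNSSolutionOn (Set.Ico 0 T) ν 0 u p) (hLH : IsLerayHopfOn T ν 0 (u 0) u)
    (hdec : HasRapidSpatialDecay (u 0)) {h : ℝ} (hh : h ≠ 0)
    (hhel : ∀ (t θ : ℝ) (x : EuclideanSpace ℝ (Fin 3)), u t (rotZ θ x + (h * θ) • eZ) = rotZ θ (u t x))
    (x₀ : EuclideanSpace ℝ (Fin 3)) (ρ M : ℝ) (hρ : 0 < ρ)
    (hM : ∀ t ∈ Set.Ico 0 T, T - ρ ^ 2 < t → ∀ x ∈ Metric.ball x₀ ρ, ‖u t x‖ * Real.sqrt (ν * (T - t)) ≤ M) :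
    IsBackwardBoundedAt u T x₀ := by
  by_contra hnot
  obtain ⟨C, v, lam, hlam, hlam0, ⟨hrate, hcont, hmild, hdiv⟩, hsing, hconv⟩ :=
    localPointZoomVelSlicesDiag ν T hν hT u p hcl hLH hdec x₀ ρ M hρ hM hnot
  set e : EuclideanSpace ℝ (Fin 3) := rotGen x₀ + h • eZ with he_def
  have he : e ≠ 0 := rotGen_add_pitch_ne_zero x₀ hh
  have htr : ∀ s < 0, ∀ (y : EuclideanSpace ℝ (Fin 3)) (l : ℝ), v s (y + l • e) = v s y := by
    intro s hs y l
    set θ : ℕ → ℝ := fun j => lam j * l with hθdef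
    set yseq : ℕ → EuclideanSpace ℝ (Fin 3) :=
      fun j => (lam j)⁻¹ • (rotZ (θ j) x₀ - x₀) + (h * l) • eZ + rotZ (θ j) y with hyseqdef
    have hθ0 : Tendsto θ atTop (𝓝 0) := by simpa [hθdef] using hlam0.mul_const l
    have hRy : Tendsto (fun j => rotZ (θ j) y) atTop (𝓝 y) := by
      have hc := (continuous_rotZ_uncurry.tendsto ((0 : ℝ), y)).comp (hθ0.prodMk_nhds tendsto_const_nhds)
      simpa [Function.comp_def, rotZ_zero] using hc
    have hyseq : Tendsto yseq atTop (𝓝 (y + l • e)) := by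
      have hc := ((tendsto_rotZ_slope hlam hlam0 x₀ l).add
        (tendsto_const_nhds (x := (h * l) • (eZ : EuclideanSpace ℝ (Fin 3))))).add hRy
      have e1 : l • rotGen x₀ + (h * l) • (eZ : EuclideanSpace ℝ (Fin 3)) + y = y + l • e := by
        rw [he_def, smul_add, smul_smul, mul_comm l h]; abel
      rw [e1] at hc
      exact hc
    -- the identity `x₀ + λⱼ yⱼ = S_{θⱼ} (x₀ + λⱼ y)` for the screw motion `S_θ x = R_θ x + (h θ) e₂`
    have hpts : ∀ j, x₀ + lam j • yseq j = rotZ (θ j) (x₀ + lam j • y) + (h * θ j) • eZ := by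
      intro j
      have hl0 : lam j ≠ 0 := (hlam j).ne'
      have hlin : rotZ (θ j) (x₀ + lam j • y) = rotZ (θ j) x₀ + lam j • rotZ (θ j) y := by
        have hm := map_add (rotZL (θ j)) x₀ (lam j • y)
        rw [map_smul] at hm
        simpa only [rotZL_apply] using hm
      rw [hlin, hyseqdef]
      simp only [smul_add, smul_smul, mul_inv_cancel₀ hl0, one_smul, hθdef]
      rw [show lam j * (h * l) = h * (lam j * l) by ring]
      abel
    have h1 : Tendsto (fun j => (lam j / ν) • u (T + lam j ^ 2 * s / ν) (x₀ + lam j • yseq j)) atTop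
        (𝓝 (v s (y + l • e))) := hconv s hs (y + l • e) yseq hyseq
    have h2 : Tendsto (fun j => rotZ (θ j) ((lam j / ν) • u (T + lam j ^ 2 * s / ν) (x₀ + lam j • y))) atTop
        (𝓝 (v s y)) := by
      have hc := (continuous_rotZ_uncurry.tendsto ((0 : ℝ), v s y)).comp ((hθ0).prodMk_nhds (hconv s hs y (fun _ => y)
        tendsto_const_nhds))
      simpa [Function.comp_def, rotZ_zero] using hc
    have heq : (fun j => (lam j / ν) • u (T + lam j ^ 2 * s / ν) (x₀ + lam j • yseq j)) =
        fun j => rotZ (θ j) ((lam j / ν) • u (T + lam j ^ 2 * s / ν) (x₀ + lam j • y)) := by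
      funext j
      rw [hpts j, hhel _ (θ j) (x₀ + lam j • y)]
      have hm := map_smul (rotZL (θ j)) (lam j / ν) (u (T + lam j ^ 2 * s / ν) (x₀ + lam j • y))
      simpa only [rotZL_apply] using hm.symm
    rw [heq] at h1
    exact tendsto_nhds_unique h1 h2
  exact (nonflatLiouville_of_translate_eq_slice hrate hcont hmild hdiv (s := -1) (by norm_num) he
    (fun y l => htr (-1) (by norm_num) y l)) hsing

end Summit.NavierStokesRegularity.NavierStokesRegularity.Theorems.LocalVelCompTubeDoorHelical

end
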